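import Summits.Schanuel.Schanuel.Theorems.RootDecomp1KGapCell04

/-!
# RootDecomp1KGapCell — lens 1, generation 42 «GAP CELL / INTERLACED SPECIALISATION» (lane K-R26 (α-loc)): the walls (1, ℓ_b, ρ), (1, ℓ₂, ℓ₃, ρ) (mod hNW), their π-twins and the 31077 pair (ℓ_b, ρ) HYPOTHESIS-FREE for every ρ ∈ `FactorialGapLiouville` — located order data strictly below the log-log floor; member ρ_W — continuation (RootDecomp1KGapCell05): §5 THE MEMBER ρ_W = Σ 2^{−N!(⌊√N⌋+2)} (`factorialGapLiouville_rhoW`)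

(lens-1 g42 `GapCell.lean` EDITION 3 [HOME/decomp-schanuel-lens-1/g42/ sha256 6f7828b1…, 2470 l; VERDICT L2004, EDITIONS 2+3 L2018, ACK L2023]; port by census-1 gen 17 as
`RootDecomp1KGapCell01`–`10` — see the PORT NOTE of part 01; `--supports stmt-Schanuel-33364` (04: `stmt-Schanuel-31077`); rung 0.)
-/

open Summit.Schanuel.Schanuel.Theorems.RootDecomp1KHyper
open Summit.Schanuel.Schanuel.Theorems.RootDecomp1KHyper.HyperCell
open Summit.Schanuel.Schanuel.Theorems.RootDecomp1KRelLiouvilleCell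
open Summit.Schanuel.Schanuel.Theorems.RootDecomp1KLogLogCell
open Summit.Schanuel.Schanuel.Theorems.RootDecomp1KTwoBaseCell
open LiouvilleNumber
open scoped Nat

namespace Summit.Schanuel.Schanuel.Theorems.RootDecomp1KGapCell

variable {k n : ℕ}

/-! ## §5  THE MEMBER `ρ_W = Σ_N 2^{−N!·(⌊√N⌋+2)}`: a gap-Liouville real (§7: NOT log-log-Liouville) -/

section Member

/-- The exponents `c_N = N! · (⌊√N⌋ + 2)` (`2, 3, 6, 18, 96, 480, 2160, …`): interlaced with the factorial skeleton,
`A·N! < c_N` and `A·c_N < (N+1)!` for every `A` eventually. -/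
def cW (N : ℕ) : ℕ := N ! * (Nat.sqrt N + 2)

/-- `2 * N ! ≤ cW N`. -/
theorem two_mul_factorial_le_cW (N : ℕ) : 2 * N ! ≤ cW N := by
  unfold cW; rw [Nat.mul_comm]; exact Nat.mul_le_mul_left _ (by omega)

/-- `2 ≤ cW N`. -/
theorem two_le_cW (N : ℕ) : 2 ≤ cW N :=
  le_trans (by have := Nat.factorial_pos N; omega) (two_mul_factorial_le_cW N)

/-- `0 < cW N`. -/
theorem cW_pos (N : ℕ) : 0 < cW N := by have := two_le_cW N; omega

/-- `N ≤ cW N`. -/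
theorem self_le_cW (N : ℕ) : N ≤ cW N :=
  (Nat.self_le_factorial N).trans ((Nat.le_mul_of_pos_left _ two_pos).trans (two_mul_factorial_le_cW N))

/-- `(N+1) · c_N ≤ c_{N+1}`. -/
theorem succ_mul_cW_le (N : ℕ) : (N + 1) * cW N ≤ cW (N + 1) := by
  unfold cW
  rw [Nat.factorial_succ]
  have hs : Nat.sqrt N ≤ Nat.sqrt (N + 1) := Nat.sqrt_le_sqrt (Nat.le_succ N)
  calc (N + 1) * (N ! * (Nat.sqrt N + 2)) = (N + 1) * N ! * (Nat.sqrt N + 2) := by ring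
    _ ≤ (N + 1) * N ! * (Nat.sqrt (N + 1) + 2) := Nat.mul_le_mul_left _ (by omega)

/-- `c_{N+1} ≤ 2(N+1) · c_N`. -/
theorem cW_succ_le (N : ℕ) : cW (N + 1) ≤ 2 * (N + 1) * cW N := by
  unfold cW
  rw [Nat.factorial_succ]
  have hs : Nat.sqrt (N + 1) ≤ Nat.sqrt N + 1 := Nat.sqrt_succ_le_succ_sqrt N
  calc (N + 1) * N ! * (Nat.sqrt (N + 1) + 2) ≤ (N + 1) * N ! * (2 * (Nat.sqrt N + 2)) :=
        Nat.mul_le_mul_left _ (by omega)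
    _ = 2 * (N + 1) * (N ! * (Nat.sqrt N + 2)) := by ring

/-- Strict growth `c_N < c_{N+1}`. -/
theorem cW_lt_succ (N : ℕ) : cW N < cW (N + 1) := by
  rcases Nat.eq_zero_or_pos N with h0 | hN
  · subst h0; decide
  · have h := succ_mul_cW_le N
    have h2 : cW N < (N + 1) * cW N := by
      have := cW_pos N; nlinarith
    omega

/-- `StrictMono cW`. -/
theorem cW_strictMono : StrictMono cW := strictMono_nat_of_lt_succ cW_lt_succ

/-- `cW N + j ≤ cW (N + j)`. -/
theorem cW_add_le (N j : ℕ) : cW N + j ≤ cW (N + j) := by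
  induction j with
  | zero => simp
  | succ j ih =>
    have h1 := cW_lt_succ (N + j)
    have e : N + (j + 1) = (N + j) + 1 := by omega
    rw [e]; omega

/-- The terms `a_j = 2^{−c_j}`. -/
noncomputable def aW (j : ℕ) : ℝ := 1 / (2 : ℝ) ^ cW j

/-- `0 < aW j`. -/
theorem aW_pos (j : ℕ) : 0 < aW j := by unfold aW; positivity

/-- `aW j ≤ (1 / 2 : ℝ) ^ j`. -/
theorem aW_le_geom (j : ℕ) : aW j ≤ (1 / 2 : ℝ) ^ j := by
  unfold aW
  rw [one_div_pow]
  exact one_div_le_one_div_of_le (by positivity) (pow_le_pow_right₀ (by norm_num) (self_le_cW j))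

/-- `Summable aW`. -/
theorem summable_aW : Summable aW :=
  Summable.of_nonneg_of_le (fun j => (aW_pos j).le) aW_le_geom
    (summable_geometric_of_lt_one (by norm_num) (by norm_num))

/-- **The member** `ρ_W = Σ_{j ≥ 0} 2^{−c_j}`. -/
noncomputable def rhoW : ℝ := ∑' j, aW j

/-- The numerator of the `N`-th truncation: `M_N = Σ_{j ≤ N} 2^{c_N − c_j}` (odd). -/
def MW (N : ℕ) : ℕ := ∑ j ∈ Finset.range (N + 1), 2 ^ (cW N - cW j)

/-- The `N`-th truncation `t_N = Σ_{j ≤ N} 2^{−c_j}`. -/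
noncomputable def tW (N : ℕ) : ℝ := ∑ j ∈ Finset.range (N + 1), aW j

/-- `tW N = (MW N : ℝ) / (2 : ℝ) ^ cW N`. -/
theorem tW_eq (N : ℕ) : tW N = (MW N : ℝ) / (2 : ℝ) ^ cW N := by
  unfold tW MW aW
  push_cast
  rw [Finset.sum_div]
  refine Finset.sum_congr rfl fun j hj => ?_
  have hj' : cW j ≤ cW N := cW_strictMono.monotone (by have := Finset.mem_range.mp hj; omega)
  rw [pow_sub₀ _ (by norm_num : (2 : ℝ) ≠ 0) hj']
  field_simp

/-- The numerator is odd: the truncation has EXACT denominator `2^{c_N}`. -/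
theorem coprime_MW (N : ℕ) : Nat.Coprime (MW N) 2 := by
  have hsplit : MW N = 2 * (∑ j ∈ Finset.range N, 2 ^ (cW N - cW j - 1)) + 1 := by
    unfold MW
    rw [Finset.sum_range_succ, Nat.sub_self, pow_zero, Finset.mul_sum]
    congr 1
    refine Finset.sum_congr rfl fun j hj => ?_
    have hj' := Finset.mem_range.mp hj
    have h1 : cW j < cW N := cW_strictMono hj'
    obtain ⟨t, ht⟩ : ∃ t, cW N - cW j = t + 1 := ⟨cW N - cW j - 1, by omega⟩
    rw [ht, Nat.add_sub_cancel, pow_succ']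
  rw [hsplit]
  exact (Nat.coprime_mul_left_add_left 1 2 _).mpr (Nat.coprime_one_left 2)

/-- `ρ_W = t_N + (tail)`. -/
theorem rhoW_eq_tW_add (N : ℕ) : rhoW = tW N + ∑' j, aW (j + (N + 1)) := by
  unfold rhoW tW
  rw [Summable.sum_add_tsum_nat_add (N + 1) summable_aW]

/-- `Summable fun j => aW (j + (N + 1))`. -/
theorem summable_tailW (N : ℕ) : Summable fun j => aW (j + (N + 1)) :=
  (summable_nat_add_iff (N + 1)).mpr summable_aW

/-- `0 < ∑' j, aW (j + (N + 1))`. -/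
theorem tailW_pos (N : ℕ) : 0 < ∑' j, aW (j + (N + 1)) :=
  (summable_tailW N).tsum_pos (fun _ => (aW_pos _).le) 0 (aW_pos _)

/-- The tail after `t_N` is at most `2 · 2^{−c_{N+1}}`. -/
theorem tailW_le (N : ℕ) : ∑' j, aW (j + (N + 1)) ≤ 2 / (2 : ℝ) ^ cW (N + 1) := by
  have hle : ∀ j, aW (j + (N + 1)) ≤ (1 / (2 : ℝ) ^ cW (N + 1)) * (1 / 2 : ℝ) ^ j := by
    intro j
    unfold aW
    rw [one_div_pow, one_div_mul_one_div, ← pow_add]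
    refine one_div_le_one_div_of_le (by positivity) (pow_le_pow_right₀ (by norm_num) ?_)
    have e : j + (N + 1) = (N + 1) + j := Nat.add_comm _ _
    rw [e]
    exact cW_add_le (N + 1) j
  have hgeo : Summable fun j : ℕ => (1 / (2 : ℝ) ^ cW (N + 1)) * (1 / 2 : ℝ) ^ j :=
    (summable_geometric_of_lt_one (by norm_num) (by norm_num)).mul_left _
  calc ∑' j, aW (j + (N + 1)) ≤ ∑' j : ℕ, (1 / (2 : ℝ) ^ cW (N + 1)) * (1 / 2 : ℝ) ^ j :=
        (summable_tailW N).tsum_le_tsum hle hgeo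
    _ = (1 / (2 : ℝ) ^ cW (N + 1)) * 2 := by
        rw [tsum_mul_left, tsum_geometric_of_lt_one (by norm_num) (by norm_num)]; norm_num
    _ = 2 / (2 : ℝ) ^ cW (N + 1) := by ring

/-- The truncation as a rational number `M_N / 2^{c_N}` … -/
def rW (N : ℕ) : ℚ := (MW N : ℚ) / (2 : ℚ) ^ cW N

/-- `((rW N : ℚ) : ℝ) = tW N`. -/
theorem rW_cast (N : ℕ) : ((rW N : ℚ) : ℝ) = tW N := by
  rw [tW_eq]; unfold rW; push_cast; rfl

/-- … with EXACT denominator `2^{c_N}` (the numerator is odd). -/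
theorem rW_den (N : ℕ) : (rW N).den = 2 ^ cW N := by
  have hcop : Nat.Coprime ((MW N : ℤ)).natAbs (((2 : ℤ) ^ cW N)).natAbs := by
    rw [Int.natAbs_natCast, Int.natAbs_pow]
    exact (coprime_MW N).pow_right (cW N)
  have h := Rat.den_div_eq_of_coprime (a := (MW N : ℤ)) (b := (2 : ℤ) ^ cW N) (by positivity) hcop
  have e : (((MW N : ℤ) : ℚ) / (((2 : ℤ) ^ cW N : ℤ) : ℚ)) = rW N := by unfold rW; push_cast; rfl
  rw [e] at h
  exact_mod_cast h

/-- `rhoW - (rW N : ℝ) = ∑' j, aW (j + (N + 1))`. -/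
theorem rhoW_sub_rW (N : ℕ) : rhoW - (rW N : ℝ) = ∑' j, aW (j + (N + 1)) := by
  rw [rW_cast, rhoW_eq_tW_add N]; ring

/-- **`ρ_W` IS GAP-LIOUVILLE** (witness scale for `(A, K)`: `N = max K (9(A+1)²)`, approximant `t_N`). -/
theorem factorialGapLiouville_rhoW : FactorialGapLiouville rhoW := by
  intro A K
  set N : ℕ := max K (9 * (A + 1) ^ 2) with hN
  have hKN : K ≤ N := le_max_left _ _
  have hN9 : 9 * (A + 1) ^ 2 ≤ N := le_max_right _ _
  have hsA : 3 * (A + 1) ≤ Nat.sqrt N := by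
    rw [Nat.le_sqrt]; nlinarith
  have hsq : Nat.sqrt N * Nat.sqrt N ≤ N := Nat.sqrt_le N
  have hNA : A + 1 ≤ N := by nlinarith
  have hfac : 0 < N ! := Nat.factorial_pos N
  refine ⟨N, hKN, rW N, ?_, ?_, ?_⟩
  · -- `2^{A·N!} < 2^{c_N}`
    rw [rW_den]; push_cast
    refine pow_lt_pow_right₀ (by norm_num) ?_
    unfold cW
    calc A * N ! < (Nat.sqrt N + 2) * N ! := Nat.mul_lt_mul_of_pos_right (by omega) hfac
      _ = N ! * (Nat.sqrt N + 2) := Nat.mul_comm _ _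
  · -- `(2^{c_N})^A < 2^{(N+1)!}`
    rw [rW_den]; push_cast
    rw [← pow_mul]
    refine pow_lt_pow_right₀ (by norm_num) ?_
    have key : (Nat.sqrt N + 2) * A < N + 1 := by nlinarith
    unfold cW
    rw [Nat.factorial_succ]
    calc N ! * (Nat.sqrt N + 2) * A = ((Nat.sqrt N + 2) * A) * N ! := by ring
      _ < (N + 1) * N ! := Nat.mul_lt_mul_of_pos_right key hfac
  · -- `|ρ_W − t_N| = tail ≤ 2·2^{−c_{N+1}} < 2^{−A·c_N}`
    rw [rhoW_sub_rW, abs_of_pos (tailW_pos N), rW_den]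
    push_cast
    refine lt_of_le_of_lt (tailW_le N) ?_
    rw [← pow_mul, div_lt_div_iff₀ (by positivity) (by positivity), one_mul]
    have hlt : cW N * A + 1 < cW (N + 1) := by
      have h1 := succ_mul_cW_le N
      have h2 : (A + 2) * cW N ≤ (N + 1) * cW N := Nat.mul_le_mul_right _ (by omega)
      have h3 := two_le_cW N
      nlinarith
    calc (2 : ℝ) * 2 ^ (cW N * A) = 2 ^ (cW N * A + 1) := by rw [pow_succ]; ring
      _ < 2 ^ cW (N + 1) := pow_lt_pow_right₀ (by norm_num) hlt

/-- `ρ_W` is a Liouville number and differs from every rational. -/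
theorem liouville_rhoW : Liouville rhoW := factorialGapLiouville_rhoW.liouville

end Member

end Summit.Schanuel.Schanuel.Theorems.RootDecomp1KGapCell
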